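import Summits.BirchSwinnertonDyer.BirchSwinnertonDyer.Theorems.RamifiedSevenEllipticUnitsValueOfKMCPerrinRiou
import Literature.NumberTheory.EllipticCurves.Kato2004.PerrinRiouRatio
import HarnessLib

set_option linter.dupNamespace false
set_option autoImplicit false

/-!
# Route `RamifiedSevenEllipticUnits` (rung K7r), Value crux `EllipticUnitValueSevenOfGZK`
# (stmt-BirchSwinnertonDyer-19945): the Kato–Perrin-Riou currency record
# `…RamifiedSevenEllipticUnitsValueOfKMCPerrinRiou` with the ratio binder INSTANTIATED at the CONSTRUCTED
# predicate `Kato2004.PRRatio` — the crux ⟸ KMC(T₇W) ∧ PR^×(W, 7) on 𝒞₇ where PR^×(W, 7) =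
# `PerrinRiouUpToUnitAt Kato2004.PRRatio W 7` is now a CLOSED statement (cell `bsd-cm`, seat `bsd-cm-prr-ty1`,
# row (M2) of planner D347; `--supports` 19945; theorems only; nothing asserted, no item closed)

WHY THIS FILE. Planner D136 asked for a registered stub `∀ W ∈ 𝒞₇, PerrinRiouUpToUnitAt PRRatio W 7`; D137
retracted it because over the OPEN binder `PRRatio` the schema is junk (`⊥` empties 𝒞₇, `(· = 1)` says
`7 ∤ #Ш`). The binder is now CONSTRUCTED (`Literature/…/Kato2004/PerrinRiouRatio.lean`,
`Literature.NumberTheory.EllipticCurves.Kato2004.PRRatio`: «`ℒ` is the Perrin-Riou ratio of a VALUE-PINNED Kato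
zeta datum of `(W,p)`», Burns–Kurihara–Sano Conj. 2.8 (ii) currency, scale closed by W2's DEFINED dual
exponential + Tate-duality normalisation + rational constant divided out; design record = that file's module
docstring and `pub/bsd-cm/bsd-cm-prr-ty1/SPEC-PRRATIO.md`). This file is seat k7r-c4 g9's record
(`ValueOfKMCPerrinRiou`, §3–§4) with `PRRatio := Kato2004.PRRatio`, BY NAME, so that a re-cut skeleton of the
line can name ONE research stub
  `stub_perrinRiouRatioSeven : ∀ W ∈ 𝒞₇, PerrinRiouUpToUnitAt Kato2004.PRRatio W 7`
(CLOSED; = BKS Conj. 2.8 (ii) up to a `7`-adic unit for the twists `E_D`, `D ∈ 𝒞₇`, at the ADDITIVE prime `7` —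
in NO source: Burungale–Skinner–Tian–Wan 2024 Thm. 6.4 needs `p ∤ 2N`; BKNO 2026 §1.4 «report elsewhere»)
next to KMC(T₇W) on 𝒞₇ and the image-free readings of cell bsd-potss over `(IsOf, Kato2004.PRRatio, KMC)` —
the readings being displayed PRINT inputs about a DEFINED ratio (Kato Thm. 12.4/12.5, 9.7, 6.6 (1), (14.9.3),
Prop. 14.21–22; BKS Thm. 7.3 / 7.8 (d); BK90 Prop. 3.8), `IsOf`/`KMC` still binders.

* §1 `valueSevenOfGZK_of_kmc_of_perrinRiouRatio` — THE CRUX BY NAME ⟸ readings ∧ (∀ W ∈ 𝒞₇, KMC W 7) ∧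
  (∀ W ∈ 𝒞₇, PerrinRiouUpToUnitAt Kato2004.PRRatio W 7) ∧ Cassels ∧ modularity; and
  `rubinFormulaSevenZp_of_kmc_of_perrinRiouRatio`, the registered fit witness's exact signature likewise.
* §2 `valueSevenOfGZK_iff_perrinRiouRatioOnClassCSeven` — GRANTED KMC on 𝒞₇ and the residual
  `EllipticUnitIMCSevenZp` (19944): the crux ⟺ PR^× over `Kato2004.PRRatio` on 𝒞₇.

HONEST LABEL: every statement is CONDITIONAL on displayed hypotheses; nothing about Kato's Main Conjecture,
Perrin-Riou's conjecture, the elliptic-unit IMC or BSD is asserted; no definition, no named fact, no instance;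
the crux is concluded BY NAME, never restated; the registered skeleton v4.6 is untouched (this is NOT a
stub); 19945 and 19944 stay OPEN; BSD is not proved for any curve by any of this.
[cite: BurnsKuriharaSano2019, Conj. 2.8 (p. 10), Thm. 7.3 and Thm. 7.6 (p. 29)] [cite: Kato2004Asterisque, Conj. 12.10 (p. 224), §15]
[cite: PerrinRiou1993AIF, §3.3] [cite: BurungaleSkinnerTianWan2024, Thm. 6.4 and Cor. 6.5 (p ∤ 2N only)]
[cite: BurungaleKobayashiNakamuraOta2026, §1.4 (arXiv:2608.06879 p. 8; shape only)]
-/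

noncomputable section

open scoped Classical NumberField

open WeierstrassCurve Literature.NumberTheory.EllipticCurves
open Literature.NumberTheory.EllipticCurves.Rank1Residual
open Literature.NumberTheory.EllipticCurves.Rank1Residual.Typed
open Summit.BirchSwinnertonDyer.Rank1Residual
open Summit.BirchSwinnertonDyer.Rank1Residual.Additive
open Summit.BirchSwinnertonDyer.Rank1Residual.X12.O11
open Summit.BirchSwinnertonDyer.BirchSwinnertonDyer.Theses.RamifiedSevenEllipticUnits

namespace Summit.BirchSwinnertonDyer.BirchSwinnertonDyer.Theorems.RamifiedSevenEllipticUnits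

namespace ValueOfPerrinRiouRatio

section Descent

variable {IsOf : ∀ (W : WeierstrassCurve ℚ) [W.IsElliptic] [W.IsGloballyMinimal] (p : ℕ) [Fact p.Prime],
  KatoDescentDatum p → Prop}
variable {KMC : ∀ (W : WeierstrassCurve ℚ) [W.IsElliptic] [W.IsGloballyMinimal] (p : ℕ), Prop}

/-! ## §1 THE CRUX BY NAME from KMC ∧ PR^× over `Kato2004.PRRatio` on 𝒞₇ -/

/-- **Crux 19945 `EllipticUnitValueSevenOfGZK` ⟸ KMC(T₇W) ∧ `PerrinRiouUpToUnitAt Kato2004.PRRatio W 7` at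
every `W ∈ 𝒞₇`** — over the image-free readings 1″♭ / 3♭ of cell bsd-potss at `PRRatio := Kato2004.PRRatio`
and the interface lemma, Cassels and modularity (GZK is the crux's own antecedent): seat k7r-c4 g9's
`ValueOfKMCPerrinRiou.valueSevenOfGZK_of_kmc_of_perrinRiou` with the ratio binder instantiated. The hypothesis
`hPR` is now a CLOSED statement — the shape of the ONE research stub of a Kato–Perrin-Riou re-cut of the line
(BKS Conj. 2.8 (ii) up to a `7`-adic unit at the additive prime `7`; in no source). CONDITIONAL; the crux is
concluded BY NAME; nothing booked; 19945 stays OPEN.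
[cite: BurnsKuriharaSano2019, Thm. 7.6 (p. 29) and Conj. 2.8 (p. 10)] [cite: Kato2004Asterisque, Conj. 12.10 (p. 224), §15]
[cite: PerrinRiou1993AIF, §3.3] [cite: Cassels1965ArithmeticVIII] -/
theorem valueSevenOfGZK_of_kmc_of_perrinRiouRatio
    (hC : TorsionFree.RankOneCountReading IsOf Kato2004.PRRatio)
    (hreal : TorsionFree.RealizableOfKMC IsOf KMC) (hread : ReadsTrivialKMC IsOf KMC)
    (hmod : hasEntireLFunction_rat) (hCassels : bsdRHS_eq_of_isIsogenous)
    (hKMC : ∀ (W : WeierstrassCurve ℚ) [W.IsElliptic] [W.IsGloballyMinimal] [Fact (Nat.Prime 7)],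
      X12.ClassCSeven W → KMC W 7)
    (hPR : ∀ (W : WeierstrassCurve ℚ) [W.IsElliptic] [W.IsGloballyMinimal] [Fact (Nat.Prime 7)],
      X12.ClassCSeven W → PerrinRiouUpToUnitAt Kato2004.PRRatio W 7) :
    EllipticUnitValueSevenOfGZK :=
  ValueOfKMCPerrinRiou.valueSevenOfGZK_of_kmc_of_perrinRiou hC hreal hread hmod hCassels hKMC hPR

/-- **The registered fit witness `stub_rubinFormulaSevenZp` — its EXACT signature — from KMC ∧ PR^× over
`Kato2004.PRRatio` on 𝒞₇** (and GZK, Cassels, modularity, the readings): k7r-c4 g9's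
`ValueOfKMCPerrinRiou.rubinFormulaSevenZp_of_kmc_of_perrinRiou` instantiated. CONDITIONAL.
[cite: BurnsKuriharaSano2019, Thm. 7.6 (p. 29)] [cite: BurungaleKobayashiNakamuraOta2026, §1.4 (arXiv:2608.06879 p. 8; shape only)] -/
theorem rubinFormulaSevenZp_of_kmc_of_perrinRiouRatio
    (hC : TorsionFree.RankOneCountReading IsOf Kato2004.PRRatio)
    (hreal : TorsionFree.RealizableOfKMC IsOf KMC) (hread : ReadsTrivialKMC IsOf KMC)
    (hGZK : rank_eq_analyticRank_of_analyticRank_le_one) (hmod : hasEntireLFunction_rat)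
    (hCassels : bsdRHS_eq_of_isIsogenous)
    (hKMC : ∀ (W : WeierstrassCurve ℚ) [W.IsElliptic] [W.IsGloballyMinimal] [Fact (Nat.Prime 7)],
      X12.ClassCSeven W → KMC W 7)
    (hPR : ∀ (W : WeierstrassCurve ℚ) [W.IsElliptic] [W.IsGloballyMinimal] [Fact (Nat.Prime 7)],
      X12.ClassCSeven W → PerrinRiouUpToUnitAt Kato2004.PRRatio W 7) :
    ∀ (W : WeierstrassCurve ℚ) [W.IsElliptic] [W.IsGloballyMinimal] [Fact (Nat.Prime 7)],
      X12.ClassCSeven W → X12.O11.RamifiedCMRubinFormulaAtZp W 7 :=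
  ValueOfKMCPerrinRiou.rubinFormulaSevenZp_of_kmc_of_perrinRiou hC hreal hread hGZK hmod hCassels hKMC hPR

/-! ## §2 GRANTED KMC on 𝒞₇ and the residual 19944: the crux ⟺ PR^× over `Kato2004.PRRatio` on 𝒞₇ -/

/-- **GRANTED KMC(T₇W) on 𝒞₇ and the residual `EllipticUnitIMCSevenZp` (stmt-BirchSwinnertonDyer-19944) — and
the image-free readings over `Kato2004.PRRatio` (1″♭ / 3♭ / 4♭), GZK, modularity, Gross–Zagier I.(7.3), Cassels —:
`EllipticUnitValueSevenOfGZK ↔ ∀ W ∈ 𝒞₇, PerrinRiouUpToUnitAt Kato2004.PRRatio W 7`.** k7r-c4 g9's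
`ValueOfKMCPerrinRiou.valueSevenOfGZK_iff_perrinRiouOnClassCSeven` instantiated: the kernel form of «the
research residue of K7r's Value crux IS Perrin-Riou's conjecture up to a `7`-adic unit at the additive prime `7`
for the twists `E_D`», now with BOTH sides closed statements. CONDITIONAL; nothing booked; 19945 and 19944 stay
OPEN; BSD is not proved for any curve.
[cite: BurnsKuriharaSano2019, Thm. 7.3 and Thm. 7.6 (p. 29)] [cite: Kato2004Asterisque, Conj. 12.10 (p. 224), §15]
[cite: PerrinRiou1993AIF, §3.3] [cite: GrossZagier1986, Thm. I.(7.3)] -/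
theorem valueSevenOfGZK_iff_perrinRiouRatioOnClassCSeven
    (hC : TorsionFree.RankOneCountReading IsOf Kato2004.PRRatio)
    (hrat : TorsionFree.HasPRRatio Kato2004.PRRatio)
    (hreal : TorsionFree.RealizableOfKMC IsOf KMC) (hread : ReadsTrivialKMC IsOf KMC)
    (hGZK : rank_eq_analyticRank_of_analyticRank_le_one) (hmod : hasEntireLFunction_rat)
    (hGZ : GrossZagier1986_thm_I_7_3) (hCassels : bsdRHS_eq_of_isIsogenous)
    (hKMC : ∀ (W : WeierstrassCurve ℚ) [W.IsElliptic] [W.IsGloballyMinimal] [Fact (Nat.Prime 7)],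
      X12.ClassCSeven W → KMC W 7)
    (h1 : EllipticUnitIMCSevenZp) :
    EllipticUnitValueSevenOfGZK ↔
      ∀ (W : WeierstrassCurve ℚ) [W.IsElliptic] [W.IsGloballyMinimal] [Fact (Nat.Prime 7)],
        X12.ClassCSeven W → PerrinRiouUpToUnitAt Kato2004.PRRatio W 7 :=
  ValueOfKMCPerrinRiou.valueSevenOfGZK_iff_perrinRiouOnClassCSeven hC hrat hreal hread hGZK hmod hGZ
    hCassels hKMC h1

end Descent

end ValueOfPerrinRiouRatio

end Summit.BirchSwinnertonDyer.BirchSwinnertonDyer.Theorems.RamifiedSevenEllipticUnits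

end
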